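import Literature.MathematicalPhysics.KineticTheory.InfiniteChainClusteringTransfer
import Literature.MathematicalPhysics.KineticTheory.ZeroWavenumberDataOfClustering
import Literature.MathematicalPhysics.KineticTheory.InfiniteChainGibbsInvariance
import Literature.MathematicalPhysics.KineticTheory.InfiniteChainTwoPointContinuity
import Literature.MathematicalPhysics.KineticTheory.InfiniteChainCorrelationContinuity
import Literature.MathematicalPhysics.KineticTheory.InfiniteChainCurrentMoments
import Literature.MathematicalPhysics.KineticTheory.InfiniteChainEnergyDensityMoments
import Literature.MathematicalPhysics.KineticTheory.InfiniteChainGoodSetSymmetries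
import Summits.AtomisticToContinuum.FouriersLaw.Theses.EmbeddedDrudeMourre

/-!
# `EmbeddedDrudeMourre.DrudeDissolution`, line `Sketch` — stub H `stub_gibbsClustering`
# ASSEMBLED from spatial mixing (M) and fixed-time `L²`-locality of the flow (L)

Item `stmt-AtomisticToContinuum-12593` (crux `DrudeDissolution` of route `EmbeddedDrudeMourre`,
sub-problem `FouriersLaw`); the registered infrastructure stub H = `stub_gibbsClustering` of the line
skeleton `Cruxes/DrudeDissolution/Lines/Sketch.lean` (registered VERBATIM on the sibling crux
stmt-AtomisticToContinuum-12594 as well). H asks, for the canonical Buttà–Marchioro dynamics `D` of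
`pinnedChain ω₂ lam β γ` and every `T > 0`, for a shift-invariant, superstable, reflection-invariant
DLR state `μ` at `T` with two DYNAMICAL clustering clauses: summability of
`x ↦ Cov_μ(a, (b ∘ τ_x) ∘ φ_u)` (`a, b ∈ {j₀, h₀}`, every `u`) and continuity at `0` of
`t ↦ Σ_x Cov_μ(a, (a ∘ τ_x) ∘ φ_t)`.

`gibbsClustering_at_of_mixing_of_locality` (registered sub-goal) PROVES H, at each parameter point
`(ω₂, lam, β, γ, T, D)`, from two typed inputs, both theorem-grade and both being built elsewhere in
the tree:

* (M) **a mixing regular state**: at every `T > 0` a DLR state of `pinnedChain` which is shift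
  invariant, superstable, reflection invariant AND exponentially ρ-mixing between half-lines, in the
  verbatim form of `stub_regularMixing` of crux `GreenKuboContinuation` (transfer-operator state of
  `Theorems.MourreDissolution.exists_gibbsState_pinnedChain` + Jentzsch–Kreĭn–Rutman gap);
* (L) **fixed-time `L²`-locality of the flow, uniform on compact time intervals**: for every regular
  state `μ` at `T`, `b ∈ {j₀, h₀}` and horizon `S`, approximants of `b ∘ φ_u`, `|u| ≤ S`, localised
  in `[-(n+K), n+K]` with `L²(μ)`-error `ε_n`, `Σ ε_n < ∞` (Buttà–Marchioro 2016 §3; deterministic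
  half in tree: `InfiniteChainFlowLocality.lean`).

The glue is the tree's clustering transfer (`InfiniteChainClusteringTransfer.lean`:
`summable_covariance_comp_chainShift_comp`, `continuousAt_tsum_covariance_comp_chainShift_comp`),
the everywhere commutation of the canonical flow with translations (`flow_chainShift_of_eq_id`),
invariance of superstable Gibbs states under the canonical flow
(`preservesMeasure_of_carrier_eq_bmGood`), the superstability moments of `j₀, h₀`, and the termwise
continuity of two-point functions (`InfiniteChainCorrelationContinuity`,
`InfiniteChainTwoPointContinuity`).
-/

noncomputable section

namespace Summit.AtomisticToContinuum.FouriersLaw.Theorems.DrudeDissolution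

open Filter Topology MeasureTheory ProbabilityTheory Set Function
open Literature.MathematicalPhysics.KineticTheory
open Literature.MathematicalPhysics.KineticTheory.HeatConduction

/-! ## Locality and regularity of the two generators `j₀`, `h₀` -/

/-- `j₀` depends on the sites `0, 1`, hence on `[-1, 1]`. [folklore] -/
theorem dependsOn_bondCurrentZ_zero (P : OscillatorChain) :
    DependsOn (fun σ : ChainConfig => P.bondCurrentZ σ 0) (Set.Icc (-((1 : ℕ) : ℤ)) ((1 : ℕ) : ℤ)) := by
  intro σ σ' h
  have h0 : σ 0 = σ' 0 := h 0 ⟨by norm_num, by norm_num⟩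
  have h1 : σ (0 + 1) = σ' (0 + 1) := h (0 + 1) ⟨by norm_num, by norm_num⟩
  simp only [OscillatorChain.bondCurrentZ, h0, h1]

/-- `h₀` depends on the sites `-1, 0, 1`. [folklore] -/
theorem dependsOn_energyDensityZ_zero (P : OscillatorChain) :
    DependsOn (fun σ : ChainConfig => P.energyDensityZ σ 0) (Set.Icc (-((1 : ℕ) : ℤ)) ((1 : ℕ) : ℤ)) := by
  intro σ σ' h
  have h0 : σ 0 = σ' 0 := h 0 ⟨by norm_num, by norm_num⟩
  have h1 : σ (0 + 1) = σ' (0 + 1) := h (0 + 1) ⟨by norm_num, by norm_num⟩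
  have hm1 : σ (0 - 1) = σ' (0 - 1) := h (0 - 1) ⟨by norm_num, by norm_num⟩
  simp only [OscillatorChain.energyDensityZ, h0, h1, hm1]

/-- `a (τ_x ρ) = a_x ρ` for `a = j₀`: `(j₀ ∘ τ_x) ∘ φ = j_x ∘ φ`. [folklore] -/
theorem bondCurrentZ_zero_chainShift (P : OscillatorChain) (x : ℤ) (ρ : ChainConfig) :
    P.bondCurrentZ (chainShift x ρ) 0 = P.bondCurrentZ ρ x := by
  rw [OscillatorChain.bondCurrentZ_chainShift, zero_add]

/-- `h₀ (τ_x ρ) = h_x ρ`. [folklore] -/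
theorem energyDensityZ_zero_chainShift (P : OscillatorChain) (x : ℤ) (ρ : ChainConfig) :
    P.energyDensityZ (chainShift x ρ) 0 = P.energyDensityZ ρ x := by
  rw [OscillatorChain.energyDensityZ_chainShift, zero_add]

/-! ## The two dynamical clauses for one generic generator -/

section Generic

variable {ω₂ lam β γ : ℝ} {μ : Measure ChainConfig} [IsProbabilityMeasure μ]
  {D : InfiniteChainDynamics (pinnedChain ω₂ lam β γ)}

/-- **Continuity at `0` of one term** `t ↦ Cov_μ(a, (a ∘ τ_x) ∘ φ_t)`, from continuity of the
two-point function `t ↦ ∫ a · (a_x ∘ φ_t) dμ` and invariance of `μ` under `τ_x` and `φ_t`. [folklore] -/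
theorem continuousAt_covariance_term (hτ : ∀ x : ℤ, MeasurePreserving (chainShift x) μ μ)
    (hφ : ∀ t : ℝ, MeasurePreserving (D.flow t) μ μ)
    {a : ChainConfig → ℝ} (ham : Measurable a) (ha2 : MemLp a 2 μ) (ax : ℤ → ChainConfig → ℝ)
    (hax : ∀ (x : ℤ) (ρ : ChainConfig), a (chainShift x ρ) = ax x ρ)
    (hcont : ∀ x : ℤ, Continuous fun t : ℝ => ∫ σ, a σ * ax x (D.flow t σ) ∂μ) (x : ℤ) :
    ContinuousAt (fun t : ℝ => cov[a, (a ∘ chainShift x) ∘ D.flow t; μ]) 0 := by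
  have hrepr : (fun t : ℝ => cov[a, (a ∘ chainShift x) ∘ D.flow t; μ]) =
      fun t : ℝ => (∫ σ, a σ * ax x (D.flow t σ) ∂μ) - (∫ σ, a σ ∂μ) * ∫ σ, a σ ∂μ := by
    funext t
    have hY : MemLp ((a ∘ chainShift x) ∘ D.flow t) 2 μ :=
      (ha2.comp_measurePreserving (hτ x)).comp_measurePreserving (hφ t)
    rw [covariance_eq_sub ha2 hY]
    have h1 : ∫ σ, (a * ((a ∘ chainShift x) ∘ D.flow t)) σ ∂μ = ∫ σ, a σ * ax x (D.flow t σ) ∂μ := by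
      refine integral_congr_ae (Eventually.of_forall fun σ => ?_)
      simp only [Pi.mul_apply, comp_apply, hax]
    have h2 : ∫ σ, ((a ∘ chainShift x) ∘ D.flow t) σ ∂μ = ∫ σ, a σ ∂μ := by
      have hstep : ∫ σ, ((a ∘ chainShift x) ∘ D.flow t) σ ∂μ = ∫ σ, (a ∘ chainShift x) σ ∂μ := by
        have hm' : AEStronglyMeasurable (a ∘ chainShift x) (Measure.map (D.flow t) μ) := by
          rw [(hφ t).map_eq]
          exact (ham.comp (chainShift.measurable x)).aestronglyMeasurable
        have := integral_map (hφ t).measurable.aemeasurable hm'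
        rw [(hφ t).map_eq] at this
        simpa only [comp_apply] using this.symm
      rw [hstep]
      simpa only [comp_apply] using integral_comp_chainShift (hτ x) ham.aestronglyMeasurable
    rw [h1, h2]
  rw [hrepr]
  exact ((hcont x).sub continuous_const).continuousAt

end Generic

/-! ## The registered statement from (M) and (L) -/

/-- **H `stub_gibbsClustering`, at one parameter point, from a mixing regular state (M) and
fixed-time `L²`-locality of the canonical flow (L)** (registered sub-goal of crux
stmt-AtomisticToContinuum-12593; H is verbatim the stub registered on stmt-12594 too). Fix
`ω₂, lam, β > 0`, `T > 0` and the canonical dynamics `D` (carrier `bmGood`, measurable flow,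
identity off `bmGood`). (M): a shift-invariant, superstable, reflection-invariant DLR state `μ` of
`pinnedChain ω₂ lam β γ` at `T` which is exponentially ρ-mixing between half-lines (the form of
`GreenKuboContinuation`'s `stub_regularMixing`). (L): for every regular state `μ` at `T`,
`b ∈ {j₀, h₀}` and horizon `S`, a margin `K` and a summable rate `ε ≥ 0` such that for `|u| ≤ S` and
every `n` some observable localised in `[-(n+K), n+K]` (measurable, in `L²(μ)`) is within `ε n` of
`b ∘ φ_u` in `L²(μ)`. Then the conclusion of H at `(ω₂, lam, β, γ, T, D)`. Proof: clustering transfer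
(`InfiniteChainClusteringTransfer`) + `flow_chainShift_of_eq_id` +
`preservesMeasure_of_carrier_eq_bmGood` + superstability moments + termwise continuity
(`continuous_integral_bondCurrentZ_mul_flow_pinnedChain`,
`continuous_integral_energyDensityZ_mul_flow_pinnedChain`). [cite: ButtaMarchioro2016, §3]
[cite: Doyon2022, §4.1 Def. 4.3–4.4] -/
theorem gibbsClustering_at_of_mixing_of_locality :
    ∀ ω₂ lam β γ : ℝ, 0 < ω₂ → 0 < lam → 0 < β → ∀ T : ℝ, 0 < T →
      ∀ D : Literature.MathematicalPhysics.KineticTheory.HeatConduction.InfiniteChainDynamics (Literature.MathematicalPhysics.KineticTheory.HeatConduction.pinnedChain ω₂ lam β γ),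
        D.carrier = (Literature.MathematicalPhysics.KineticTheory.HeatConduction.pinnedChain ω₂ lam β γ).bmGood → (∀ t : ℝ, Measurable (D.flow t)) →
        (∀ t : ℝ, ∀ σ ∉ (Literature.MathematicalPhysics.KineticTheory.HeatConduction.pinnedChain ω₂ lam β γ).bmGood, D.flow t σ = σ) →
        (∃ μ : MeasureTheory.Measure (ℤ → ℝ × ℝ),
          (Literature.MathematicalPhysics.KineticTheory.HeatConduction.pinnedChain ω₂ lam β γ).IsChainGibbsMeasure T μ ∧
          Literature.MathematicalPhysics.KineticTheory.HeatConduction.IsShiftInvariant μ ∧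
          (Literature.MathematicalPhysics.KineticTheory.HeatConduction.pinnedChain ω₂ lam β γ).HasSuperstabilityEstimate μ ∧
          μ.map (fun (σ : ℤ → ℝ × ℝ) (x : ℤ) => σ (-x)) = μ ∧
          ∃ C m : ℝ, 0 < m ∧ ∀ (p : ℤ) (n : ℕ) (f g : (ℤ → ℝ × ℝ) → ℝ),
            DependsOn f {i : ℤ | i ≤ p} → DependsOn g {i : ℤ | p + n ≤ i} →
            Measurable f → Measurable g → MeasureTheory.MemLp f 2 μ → MeasureTheory.MemLp g 2 μ →
            |MeasureTheory.integral μ (fun σ => f σ * g σ) -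
                MeasureTheory.integral μ f * MeasureTheory.integral μ g| ≤
              C * Real.exp (-(m * n)) * (MeasureTheory.integral μ (fun σ => f σ ^ 2)) ^ (1 / 2 : ℝ) *
                (MeasureTheory.integral μ (fun σ => g σ ^ 2)) ^ (1 / 2 : ℝ)) →
        (∀ μ : MeasureTheory.Measure (ℤ → ℝ × ℝ),
          (Literature.MathematicalPhysics.KineticTheory.HeatConduction.pinnedChain ω₂ lam β γ).IsChainGibbsMeasure T μ →
          Literature.MathematicalPhysics.KineticTheory.HeatConduction.IsShiftInvariant μ →
          (Literature.MathematicalPhysics.KineticTheory.HeatConduction.pinnedChain ω₂ lam β γ).HasSuperstabilityEstimate μ →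
          ∀ b ∈ ({fun σ => (Literature.MathematicalPhysics.KineticTheory.HeatConduction.pinnedChain ω₂ lam β γ).bondCurrentZ σ 0,
              fun σ => (Literature.MathematicalPhysics.KineticTheory.HeatConduction.pinnedChain ω₂ lam β γ).energyDensityZ σ 0} : Set ((ℤ → ℝ × ℝ) → ℝ)),
          ∀ S : ℝ, ∃ (K : ℕ) (ε : ℕ → ℝ), (∀ n, 0 ≤ ε n) ∧ Summable ε ∧
            ∀ u ∈ Set.Icc (-S) S, ∀ n : ℕ, ∃ h : (ℤ → ℝ × ℝ) → ℝ,
              DependsOn h (Set.Icc (-((n + K : ℕ) : ℤ)) (n + K : ℕ)) ∧ Measurable h ∧ MeasureTheory.MemLp h 2 μ ∧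
              Real.sqrt (∫ σ, (b (D.flow u σ) - h σ) ^ 2 ∂μ) ≤ ε n) →
        ∃ μ : MeasureTheory.Measure (ℤ → ℝ × ℝ),
          (Literature.MathematicalPhysics.KineticTheory.HeatConduction.pinnedChain ω₂ lam β γ).IsChainGibbsMeasure T μ ∧ Literature.MathematicalPhysics.KineticTheory.HeatConduction.IsShiftInvariant μ ∧
          (Literature.MathematicalPhysics.KineticTheory.HeatConduction.pinnedChain ω₂ lam β γ).HasSuperstabilityEstimate μ ∧
          μ.map (fun (σ : ℤ → ℝ × ℝ) (x : ℤ) => σ (-x)) = μ ∧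
          (∀ a ∈ ({fun σ => (Literature.MathematicalPhysics.KineticTheory.HeatConduction.pinnedChain ω₂ lam β γ).bondCurrentZ σ 0,
              fun σ => (Literature.MathematicalPhysics.KineticTheory.HeatConduction.pinnedChain ω₂ lam β γ).energyDensityZ σ 0} : Set ((ℤ → ℝ × ℝ) → ℝ)),
            ∀ b ∈ ({fun σ => (Literature.MathematicalPhysics.KineticTheory.HeatConduction.pinnedChain ω₂ lam β γ).bondCurrentZ σ 0,
              fun σ => (Literature.MathematicalPhysics.KineticTheory.HeatConduction.pinnedChain ω₂ lam β γ).energyDensityZ σ 0} : Set ((ℤ → ℝ × ℝ) → ℝ)),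
            ∀ u : ℝ, Summable fun x : ℤ =>
              ProbabilityTheory.covariance a ((b ∘ Literature.MathematicalPhysics.KineticTheory.HeatConduction.chainShift x) ∘ D.flow u) μ) ∧
          (∀ a ∈ ({fun σ => (Literature.MathematicalPhysics.KineticTheory.HeatConduction.pinnedChain ω₂ lam β γ).bondCurrentZ σ 0,
              fun σ => (Literature.MathematicalPhysics.KineticTheory.HeatConduction.pinnedChain ω₂ lam β γ).energyDensityZ σ 0} : Set ((ℤ → ℝ × ℝ) → ℝ)),
            ContinuousAt (fun t : ℝ => ∑' x : ℤ,
              ProbabilityTheory.covariance a ((a ∘ Literature.MathematicalPhysics.KineticTheory.HeatConduction.chainShift x) ∘ D.flow t) μ) 0) := by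
  intro ω₂ lam β γ hω hl hβ T hT D hcar hmeas hid hM hL
  obtain ⟨μ, hG, hS, hSS, hrefl, C, m, hm, hmix⟩ := hM
  haveI := hG.isProbabilityMeasure
  -- the tree's inputs
  have hU0 : ∀ r, 0 ≤ (pinnedChain ω₂ lam β γ).U r := OscillatorChain.pinnedChain_U_nonneg β γ hω.le hl.le
  have hV0 : ∀ r, 0 ≤ (pinnedChain ω₂ lam β γ).V r := OscillatorChain.pinnedChain_V_nonneg ω₂ lam γ hβ.le
  have hτ : ∀ x : ℤ, MeasurePreserving (chainShift x) μ μ := hS.measurePreserving_chainShift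
  have hpres : D.PreservesMeasure μ :=
    OscillatorChain.preservesMeasure_of_carrier_eq_bmGood one_le_two one_le_two
      (OscillatorChain.pinnedChain_isEvenPolyOfDegree_U β γ hω.le hl)
      (OscillatorChain.pinnedChain_isEvenPolyOfDegree_V ω₂ lam γ hβ) D hcar hmeas hG hSS
  have hφ : ∀ t : ℝ, MeasurePreserving (D.flow t) μ μ := hpres.2
  have hcomm : ∀ (t : ℝ) (x : ℤ), D.flow t ∘ chainShift x = chainShift x ∘ D.flow t :=
    fun t x => funext fun σ => D.flow_chainShift_of_eq_id hcar hid hU0 hV0 t x σ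
  -- regularity of the generators
  have hj4 : MemLp (fun σ => (pinnedChain ω₂ lam β γ).bondCurrentZ σ 0) 2 μ :=
    OscillatorChain.memLp_bondCurrentZ_pinnedChain γ hω.le hl.le hβ hSS 0 (by norm_num)
  have hh4 : MemLp (fun σ => (pinnedChain ω₂ lam β γ).energyDensityZ σ 0) 2 μ :=
    OscillatorChain.memLp_energyDensityZ_pinnedChain γ hω.le hl.le hβ.le hSS 0 (by norm_num)
  have hjP : DependsOn (fun σ => (pinnedChain ω₂ lam β γ).bondCurrentZ σ 0) (Set.Icc (-((1 : ℕ) : ℤ)) ((1 : ℕ) : ℤ)) ∧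
      Measurable (fun σ => (pinnedChain ω₂ lam β γ).bondCurrentZ σ 0) ∧
      MemLp (fun σ => (pinnedChain ω₂ lam β γ).bondCurrentZ σ 0) 2 μ ∧
      ∃ ax : ℤ → ChainConfig → ℝ,
        (∀ (x : ℤ) (ρ : ChainConfig), (fun σ => (pinnedChain ω₂ lam β γ).bondCurrentZ σ 0) (chainShift x ρ) = ax x ρ) ∧
        ∀ x : ℤ, Continuous fun t : ℝ =>
          ∫ σ, (fun σ => (pinnedChain ω₂ lam β γ).bondCurrentZ σ 0) σ * ax x (D.flow t σ) ∂μ :=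
    ⟨dependsOn_bondCurrentZ_zero _, measurable_bondCurrentZ _ 0, hj4,
      fun x ρ => (pinnedChain ω₂ lam β γ).bondCurrentZ ρ x,
      fun x ρ => bondCurrentZ_zero_chainShift _ x ρ,
      fun x => D.continuous_integral_bondCurrentZ_mul_flow_pinnedChain γ hω.le hl.le hβ hSS hpres x 0⟩
  have hhP : DependsOn (fun σ => (pinnedChain ω₂ lam β γ).energyDensityZ σ 0) (Set.Icc (-((1 : ℕ) : ℤ)) ((1 : ℕ) : ℤ)) ∧
      Measurable (fun σ => (pinnedChain ω₂ lam β γ).energyDensityZ σ 0) ∧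
      MemLp (fun σ => (pinnedChain ω₂ lam β γ).energyDensityZ σ 0) 2 μ ∧
      ∃ ax : ℤ → ChainConfig → ℝ,
        (∀ (x : ℤ) (ρ : ChainConfig), (fun σ => (pinnedChain ω₂ lam β γ).energyDensityZ σ 0) (chainShift x ρ) = ax x ρ) ∧
        ∀ x : ℤ, Continuous fun t : ℝ =>
          ∫ σ, (fun σ => (pinnedChain ω₂ lam β γ).energyDensityZ σ 0) σ * ax x (D.flow t σ) ∂μ :=
    ⟨dependsOn_energyDensityZ_zero _,
      OscillatorChain.measurable_energyDensityZ _ (OscillatorChain.measurable_pinnedChain_U ω₂ lam β γ)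
        (OscillatorChain.measurable_pinnedChain_V ω₂ lam β γ) 0, hh4,
      fun x ρ => (pinnedChain ω₂ lam β γ).energyDensityZ ρ x,
      fun x ρ => energyDensityZ_zero_chainShift _ x ρ,
      fun x => D.continuous_integral_energyDensityZ_mul_flow_pinnedChain γ hω.le hl.le hβ hSS hpres x 0⟩
  have hgen : ∀ a ∈ ({fun σ => (pinnedChain ω₂ lam β γ).bondCurrentZ σ 0,
      fun σ => (pinnedChain ω₂ lam β γ).energyDensityZ σ 0} : Set (ChainConfig → ℝ)),
      DependsOn a (Set.Icc (-((1 : ℕ) : ℤ)) ((1 : ℕ) : ℤ)) ∧ Measurable a ∧ MemLp a 2 μ ∧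
        ∃ ax : ℤ → ChainConfig → ℝ, (∀ (x : ℤ) (ρ : ChainConfig), a (chainShift x ρ) = ax x ρ) ∧
          ∀ x : ℤ, Continuous fun t : ℝ => ∫ σ, a σ * ax x (D.flow t σ) ∂μ := by
    intro a ha
    rcases ha with h | h
    · subst h; exact hjP
    · rw [Set.mem_singleton_iff] at h; subst h; exact hhP
  refine ⟨μ, hG, hS, hSS, hrefl, ?_, ?_⟩
  · -- clause (i): summable space–time clustering at every fixed time `u`
    intro a ha b hb u
    obtain ⟨hadep, ham, ha2, -⟩ := hgen a ha
    obtain ⟨-, hbm, hb2, -⟩ := hgen b hb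
    obtain ⟨K, ε, hε0, hε, hloc⟩ := hL μ hG hS hSS b hb |u|
    have hu : u ∈ Set.Icc (-|u|) |u| := ⟨neg_abs_le u, le_abs_self u⟩
    refine summable_covariance_comp_chainShift_comp hmix hm hτ hadep ham ha2 K (hcomm u)
      (hbm.comp (hmeas u)) (hb2.comp_measurePreserving (hφ u)) hε0 hε fun n => ?_
    obtain ⟨h, hhdep, hhm, hh2, hherr⟩ := hloc u hu n
    exact ⟨h, hhdep, hhm, hh2, by simpa only [comp_apply] using hherr⟩
  · -- clause (ii): continuity at `t = 0` of the summed autocovariance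
    intro a ha
    obtain ⟨hadep, ham, ha2, ax, hax, hcont⟩ := hgen a ha
    obtain ⟨K, ε, hε0, hε, hloc⟩ := hL μ hG hS hSS a ha 1
    refine continuousAt_tsum_covariance_comp_chainShift_comp hmix hm hτ hadep ham ha2 K
      (Real.sqrt (∫ σ, a σ ^ 2 ∂μ)) hε0 hε hcomm ?_
      (continuousAt_covariance_term hτ hφ ham ha2 ax hax hcont)
    have hnhds : Set.Icc (-(1 : ℝ)) 1 ∈ 𝓝 (0 : ℝ) := Icc_mem_nhds (by norm_num) (by norm_num)
    filter_upwards [hnhds] with t ht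
    refine ⟨ham.comp (hmeas t), ha2.comp_measurePreserving (hφ t), le_of_eq ?_, fun n => ?_⟩
    · -- `‖a ∘ φ_t‖₂ = ‖a‖₂` by invariance
      have hm' : AEStronglyMeasurable (fun σ => a σ ^ 2) (Measure.map (D.flow t) μ) := by
        rw [(hφ t).map_eq]; exact (ham.pow_const 2).aestronglyMeasurable
      have key : ∫ σ, a (D.flow t σ) ^ 2 ∂μ = ∫ σ, a σ ^ 2 ∂μ := by
        have := integral_map (hφ t).measurable.aemeasurable hm'
        rw [(hφ t).map_eq] at this
        simpa only using this.symm
      simp only [comp_apply, key]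
    · obtain ⟨h, hhdep, hhm, hh2, hherr⟩ := hloc t ht n
      exact ⟨h, hhdep, hhm, hh2, by simpa only [comp_apply] using hherr⟩

end Summit.AtomisticToContinuum.FouriersLaw.Theorems.DrudeDissolution

end
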